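import Literature.Geometry.Lorentzian.SurfaceCurvatureFlux
import Literature.Geometry.Lorentzian.GreenIdentityCompactSupport
import Literature.Geometry.Lorentzian.DalembertianCompose
import HarnessLib

/-!
# The flux formula for the total curvature of a compactly supported piece of a (non-compact)
# Riemannian surface

`SurfaceCurvatureFlux.lean` proves, on a **compact** Riemannian surface `(N, h)` without boundary,
the flux formula

  `∫_N ψ S dμ = −∫_N (⟨du, dψ⟩ − 2 L ⟨df, dψ⟩) / u dμ`        (`S = 2K`, `u = |∇f|²`, `L = Δf`)

for `f, ψ ∈ C^∞(N)` with `df ≠ 0` on `tsupport ψ` — the integrated exactness `K dA = dω₁₂` of the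
curvature form off the critical points of `f` (Chern 1944, §1–§2), the device by which a
Gauss–Bonnet integral is reduced to fluxes. The same formula holds on a **non-compact** surface for
a **compactly supported** test function `ψ ∈ C_c^∞(N)`: this is the form needed on the complete
non-compact area-minimising surface `S ≅ ℝ²` of Schoen–Yau's proof of the positive mass theorem
(Comm. Math. Phys. 65 (1979), §2, Step 3, second proof of the Claim `∫_S K ≤ 0`, pp. 57–63: the
Gauss–Bonnet theorem with boundary on the exhaustion `D_σ = {r' ≤ σ}` of `S`, whose boundary term
`∫_{∂D_σ} k_g` is a flux through the level set `{r' = σ}`; with `ψ = η ∘ r'` a cut-off of the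
level `σ` the right-hand side above is exactly such a flux, smeared over `supp η'`).

This file proves it (`integral_mul_scalarCurvature_eq_neg_integral_flux_of_hasCompactSupport`), by
the argument of `SurfaceCurvatureFlux.lean` verbatim — the pointwise transgression identity
`half_scalarCurvature_mul_gradSq_sq` (`SurfaceTransgression.lean`) tested against `ψ/u²` — with
Green's first identity for compactly supported functions on a non-compact manifold
(`integral_mul_dalembertian_eq_neg_integral_innerDual_of_hasCompactSupport`,
`GreenIdentityCompactSupport.lean`) in place of the compact one, and integrability from the compact
support of every integrand (each carries a factor `ψ` or `dψ`), and its specialisation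
`integral_comp_mul_scalarCurvature_eq` to a cut-off `ψ = η ∘ f` of the levels of `f`:
`∫ (η ∘ f) S dμ = −∫ η'(f) (g⁻¹(d|∇f|², df) − 2 Δf |∇f|²)/|∇f|² dμ` — the curvature integral of
the (smeared) sublevel sets of `f` as a flux through its level curves, whose density
`(g⁻¹(d|∇f|², df)/(2|∇f|²) − Δf)/|∇f|` is the signed geodesic curvature of the level curves
(`LevelCurveGeodesicCurvature.lean`). Everything is proved; no definitions, no named facts.

## References

* S.-S. Chern, *A simple intrinsic proof of the Gauss–Bonnet formula for closed Riemannian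
  manifolds*, Ann. of Math. 45 (1944) 747–752, §1–§2. [Chern1944]
* J. M. Lee, *Introduction to Riemannian Manifolds*, 2nd ed. (2018), Problem 2-23 (Green's
  identities), Thm. 9.3 (Gauss–Bonnet formula for a domain), Thm. 9.7. [Lee2018]
* R. Schoen, S.-T. Yau, *On the proof of the positive mass conjecture in general relativity*,
  Comm. Math. Phys. 65 (1979) 45–76, §2, pp. 57–63 (second proof of the Claim: Gauss–Bonnet with
  boundary on `D_σ ⊂ S`, (2.26)–(2.27)). [SchoenYauPMT1979]
-/

noncomputable section

open Bundle Set Function Filter Module TopologicalSpace MeasureTheory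
open scoped Manifold ContDiff Topology

namespace Literature.Geometry.Lorentzian

open Literature.Geometry.Riemannian PseudoRiemannianMetric

section Core

variable {H : Type*} [TopologicalSpace H]
  {I : ModelWithCorners ℝ (EuclideanSpace ℝ (Fin 2)) H} [I.Boundaryless]
  {N : Type*} [TopologicalSpace N] [ChartedSpace H N] [IsManifold I ∞ N]
  [T2Space N] [LocallyCompactSpace N] [SigmaCompactSpace N] [MeasurableSpace N] [BorelSpace N]
  (h : ContMDiffRiemannianMetric I ∞ (EuclideanSpace ℝ (Fin 2)) (TangentSpace I : N → Type _))
  [(ofRiemannian h).HasLeviCivita]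

/-- **The flux formula for the curvature of a Riemannian surface against a compactly supported
test function.** Let `(N, h)` be a Riemannian surface without boundary modelled on `ℝ²` (not
necessarily compact; Hausdorff, locally compact, σ-compact), `f ∈ C^∞(N)` with `u = |∇f|²_h`,
`L = Δ_h f`, and `ψ ∈ C_c^∞(N)` with `df ≠ 0` on `tsupport ψ`. Then

  `∫_N ψ S_h dμ_h = −∫_N (h⁻¹(du, dψ) − 2 L h⁻¹(df, dψ)) / u dμ_h`,

`S_h = 2K` the scalar curvature. The right-hand side is `−2∫ dψ(W) dμ`,
`W = ∇_{e₁}e₁ − (div e₁)e₁`, `e₁ = ∇f/|∇f|`: the integrated exactness `K dA = dω₁₂` of the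
curvature form off the critical points of `f` (Chern 1944, §1–§2), from the pointwise identity
`half_scalarCurvature_mul_gradSq_sq` and Green's first identity for compactly supported functions
(Lee 2018, Problem 2-23) applied to the pairs `(ψ/u, u)` and `(ψL/u, f)`. For `ψ = η ∘ f` a cut-off
of a regular level this is the flux (Gauss–Bonnet boundary) term of Schoen–Yau 1979, §2, (2.26),
on the non-compact surface `S`. [cite: Chern1944, §1–§2] [cite: Lee2018, Problem 2-23 (a)] -/
theorem integral_mul_scalarCurvature_eq_neg_integral_flux_of_hasCompactSupport {f ψ : N → ℝ}
    (hf : CMDiff ∞ f) (hψ : CMDiff ∞ ψ) (hψc : HasCompactSupport ψ)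
    (hsupp : ∀ x ∈ tsupport ψ, (ofRiemannian h).gradSq f x ≠ 0) :
    ∫ x, ψ x * (ofRiemannian h).scalarCurvature x ∂riemannianMeasure h =
      -∫ x, ((ofRiemannian h).innerDual x
                (mvfderiv I ((ofRiemannian h).gradSq f) x : TangentSpace I x →ₗ[ℝ] ℝ)
                (mvfderiv I ψ x : TangentSpace I x →ₗ[ℝ] ℝ)
              - 2 * (ofRiemannian h).dalembertian f x *
                (ofRiemannian h).innerDual x (mvfderiv I f x : TangentSpace I x →ₗ[ℝ] ℝ)
                  (mvfderiv I ψ x : TangentSpace I x →ₗ[ℝ] ℝ)) /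
            (ofRiemannian h).gradSq f x ∂riemannianMeasure h := by
  have hg : (ofRiemannian h).IsRiemannian := fun p v hv ↦ isRiemannian_ofRiemannian h p v hv
  have h2 : finrank ℝ (EuclideanSpace ℝ (Fin 2)) = 2 := finrank_euclideanSpace_fin
  have h2le : (2 : ℕ∞ω) ≤ ∞ := WithTop.coe_le_coe.mpr le_top
  have h1le : (1 : ℕ∞ω) ≤ ∞ := WithTop.coe_le_coe.mpr le_top
  -- the functions `u = |∇f|²`, `L = Δf` and the pairings, as atoms
  set u : N → ℝ := (ofRiemannian h).gradSq f with hu_def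
  set L : N → ℝ := (ofRiemannian h).dalembertian f with hL_def
  set S : N → ℝ := (ofRiemannian h).scalarCurvature with hS_def
  have hu_s : CMDiff ∞ u := contMDiff_gradSq _ hf
  have hL_s : CMDiff ∞ L := contMDiff_dalembertian _ hf
  have hS_s : CMDiff ∞ S := contMDiff_scalarCurvature _
  -- the test functions `φ₁ = ψ/u`, `φ₂ = ψL/u`
  set φ₁ : N → ℝ := fun x ↦ ψ x / u x with hφ₁
  set φ₂ : N → ℝ := fun x ↦ ψ x * L x / u x with hφ₂
  have hψL : CMDiff ∞ fun x ↦ ψ x * L x := hψ.mul hL_s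
  have hsuppL : ∀ x ∈ tsupport (fun x ↦ ψ x * L x), u x ≠ 0 := fun x hx ↦
    hsupp x (tsupport_mul_subset_left hx)
  have hφ₁s : CMDiff ∞ φ₁ := contMDiff_div_of_tsupport hψ hu_s hsupp
  have hφ₂s : CMDiff ∞ φ₂ := contMDiff_div_of_tsupport hψL hu_s hsuppL
  -- the test functions are compactly supported (inside `tsupport ψ`)
  have hφ₁c : HasCompactSupport φ₁ :=
    HasCompactSupport.intro' hψc.isCompact (isClosed_tsupport ψ) fun x hx ↦ by
      simp only [hφ₁, image_eq_zero_of_notMem_tsupport hx, zero_div]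
  have hφ₂c : HasCompactSupport φ₂ :=
    HasCompactSupport.intro' hψc.isCompact (isClosed_tsupport ψ) fun x hx ↦ by
      simp only [hφ₂, image_eq_zero_of_notMem_tsupport hx, zero_mul, zero_div]
  set Puu : N → ℝ := fun x ↦ (ofRiemannian h).innerDual x
    (mvfderiv I u x : TangentSpace I x →ₗ[ℝ] ℝ) (mvfderiv I u x : TangentSpace I x →ₗ[ℝ] ℝ) with hPuu
  set PLf : N → ℝ := fun x ↦ (ofRiemannian h).innerDual x
    (mvfderiv I L x : TangentSpace I x →ₗ[ℝ] ℝ) (mvfderiv I f x : TangentSpace I x →ₗ[ℝ] ℝ) with hPLf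
  set Puf : N → ℝ := fun x ↦ (ofRiemannian h).innerDual x
    (mvfderiv I u x : TangentSpace I x →ₗ[ℝ] ℝ) (mvfderiv I f x : TangentSpace I x →ₗ[ℝ] ℝ) with hPuf
  set Pψu : N → ℝ := fun x ↦ (ofRiemannian h).innerDual x
    (mvfderiv I ψ x : TangentSpace I x →ₗ[ℝ] ℝ) (mvfderiv I u x : TangentSpace I x →ₗ[ℝ] ℝ) with hPψu
  set Pψf : N → ℝ := fun x ↦ (ofRiemannian h).innerDual x
    (mvfderiv I ψ x : TangentSpace I x →ₗ[ℝ] ℝ) (mvfderiv I f x : TangentSpace I x →ₗ[ℝ] ℝ) with hPψf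
  set P1 : N → ℝ := fun x ↦ (ofRiemannian h).innerDual x
    (mvfderiv I φ₁ x : TangentSpace I x →ₗ[ℝ] ℝ) (mvfderiv I u x : TangentSpace I x →ₗ[ℝ] ℝ) with hP1
  set P2 : N → ℝ := fun x ↦ (ofRiemannian h).innerDual x
    (mvfderiv I φ₂ x : TangentSpace I x →ₗ[ℝ] ℝ) (mvfderiv I f x : TangentSpace I x →ₗ[ℝ] ℝ) with hP2
  -- Green's identities
  have hG1 : ∫ x, φ₁ x * (ofRiemannian h).dalembertian u x ∂riemannianMeasure h =
      -∫ x, P1 x ∂riemannianMeasure h :=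
    integral_mul_dalembertian_eq_neg_integral_innerDual_of_hasCompactSupport h (hφ₁s.of_le h1le)
      hφ₁c (hu_s.of_le h2le)
  have hG2 : ∫ x, φ₂ x * L x ∂riemannianMeasure h = -∫ x, P2 x ∂riemannianMeasure h :=
    integral_mul_dalembertian_eq_neg_integral_innerDual_of_hasCompactSupport h (hφ₂s.of_le h1le)
      hφ₂c (hf.of_le h2le)
  -- differentials off the support vanish
  have hzero : ∀ {w : N → ℝ} {x : N}, x ∉ tsupport w → mvfderiv I w x = 0 := fun hx ↦
    mvfderiv_eq_zero_of_notMem_tsupport hx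
  have hψ0 : ∀ {x : N}, x ∉ tsupport ψ → ψ x = 0 := fun hx ↦ image_eq_zero_of_notMem_tsupport hx
  -- the differential of `u⁻¹` where `u ≠ 0`
  have hdinv : ∀ {x : N}, u x ≠ 0 →
      mvfderiv I (fun y ↦ (u y)⁻¹) x = (-(u x ^ 2)⁻¹) • mvfderiv I u x := by
    intro x hux
    ext v
    have hum : MDifferentiableAt I 𝓘(ℝ, ℝ) u x := (hu_s x).mdifferentiableAt (by simp)
    have hc := mvfderiv_real_comp (I := I) (u := u) (ζ := Inv.inv) (x := x)
      (differentiableAt_inv hux) hum v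
    change mvfderiv I (Inv.inv ∘ u) x v = _
    rw [hc, deriv_inv, _root_.smul_apply, smul_eq_mul]
  -- pointwise: the differentials of the test functions
  have hdφ₁ : ∀ x, P1 x = Pψu x / u x - ψ x * Puu x / u x ^ 2 := by
    intro x
    by_cases hx : x ∈ tsupport ψ
    · have hux : u x ≠ 0 := hsupp x hx
      have hψm : MDifferentiableAt I 𝓘(ℝ, ℝ) ψ x := (hψ x).mdifferentiableAt (by simp)
      have hinv : MDifferentiableAt I 𝓘(ℝ, ℝ) (fun y ↦ (u y)⁻¹) x :=
        ((hu_s x).inv₀ hux).mdifferentiableAt (by simp)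
      have hφeq : φ₁ = fun y ↦ ψ y * (u y)⁻¹ := by funext y; simp only [hφ₁, div_eq_mul_inv]
      simp only [hP1, hPψu, hPuu, innerDual]
      rw [hφeq, mvfderiv_fun_mul hψm hinv, hdinv hux]
      simp only [ContinuousLinearMap.toLinearMap_add, ContinuousLinearMap.toLinearMap_smul,
        LinearMap.add_apply, LinearMap.smul_apply, smul_eq_mul]
      field_simp
      ring
    · have hx1 : x ∉ tsupport φ₁ := fun h' ↦ hx (tsupport_div_subset ψ u h')
      simp only [hP1, hPψu, hPuu, innerDual, hzero hx1, hzero hx, hψ0 hx,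
        ContinuousLinearMap.toLinearMap_zero, LinearMap.zero_apply, zero_div, zero_mul, sub_zero]
  have hdφ₂ : ∀ x, P2 x = L x * Pψf x / u x + ψ x * PLf x / u x - ψ x * L x * Puf x / u x ^ 2 := by
    intro x
    by_cases hx : x ∈ tsupport ψ
    · have hux : u x ≠ 0 := hsupp x hx
      have hψm : MDifferentiableAt I 𝓘(ℝ, ℝ) ψ x := (hψ x).mdifferentiableAt (by simp)
      have hLm : MDifferentiableAt I 𝓘(ℝ, ℝ) L x := (hL_s x).mdifferentiableAt (by simp)
      have hψLm : MDifferentiableAt I 𝓘(ℝ, ℝ) (fun y ↦ ψ y * L y) x := hψm.mul hLm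
      have hinv : MDifferentiableAt I 𝓘(ℝ, ℝ) (fun y ↦ (u y)⁻¹) x :=
        ((hu_s x).inv₀ hux).mdifferentiableAt (by simp)
      have hφeq : φ₂ = fun y ↦ (ψ y * L y) * (u y)⁻¹ := by
        funext y; simp only [hφ₂, div_eq_mul_inv]
      simp only [hP2, hPψf, hPLf, hPuf, innerDual]
      rw [hφeq, mvfderiv_fun_mul hψLm hinv, mvfderiv_fun_mul hψm hLm, hdinv hux]
      simp only [ContinuousLinearMap.toLinearMap_add, ContinuousLinearMap.toLinearMap_smul,
        LinearMap.add_apply, LinearMap.smul_apply, smul_eq_mul, smul_add]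
      field_simp
      ring
    · have hx2 : x ∉ tsupport φ₂ := fun h' ↦ hx
        (tsupport_mul_subset_left (tsupport_div_subset (fun y ↦ ψ y * L y) u h'))
      simp only [hP2, hPψf, hPLf, hPuf, innerDual, hzero hx2, hzero hx, hψ0 hx,
        ContinuousLinearMap.toLinearMap_zero, LinearMap.zero_apply, zero_div, zero_mul,
        mul_zero, sub_zero, add_zero]
  -- pointwise: the transgression identity tested against `ψ / u²`
  have hpt : ∀ x, ψ x * S x =
      φ₁ x * (ofRiemannian h).dalembertian u x - ψ x * Puu x / u x ^ 2
        - 2 * (ψ x * PLf x / u x) + 2 * (ψ x * L x * Puf x / u x ^ 2)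
        - 2 * (φ₂ x * L x) := by
    intro x
    by_cases hx : x ∈ tsupport ψ
    · have hux : u x ≠ 0 := hsupp x hx
      have key := half_scalarCurvature_mul_gradSq_sq (ofRiemannian h) hg h2 hf x
      have e1 : (ofRiemannian h).gradSq ((ofRiemannian h).gradSq f) x = Puu x := rfl
      have e2 : (ofRiemannian h).innerDual x
          (mvfderiv I ((ofRiemannian h).dalembertian f) x : TangentSpace I x →ₗ[ℝ] ℝ)
          (mvfderiv I f x : TangentSpace I x →ₗ[ℝ] ℝ) = PLf x := rfl
      have e3 : (ofRiemannian h).innerDual x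
          (mvfderiv I ((ofRiemannian h).gradSq f) x : TangentSpace I x →ₗ[ℝ] ℝ)
          (mvfderiv I f x : TangentSpace I x →ₗ[ℝ] ℝ) = Puf x := rfl
      rw [e1, e2, e3] at key
      change S x / 2 * u x ^ 2 = 2⁻¹ * u x * (ofRiemannian h).dalembertian u x - 2⁻¹ * Puu x
        - u x * PLf x + L x * Puf x - L x ^ 2 * u x at key
      simp only [hφ₁, hφ₂]
      field_simp
      linear_combination (2 * ψ x) * key
    · simp [hφ₁, hφ₂, hψ0 hx]
  -- the seven integrands, as atoms
  set F1 : N → ℝ := fun x ↦ φ₁ x * (ofRiemannian h).dalembertian u x with hF1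
  set F2 : N → ℝ := fun x ↦ ψ x * Puu x / u x ^ 2 with hF2
  set F3 : N → ℝ := fun x ↦ ψ x * PLf x / u x with hF3
  set F4 : N → ℝ := fun x ↦ ψ x * L x * Puf x / u x ^ 2 with hF4
  set F5 : N → ℝ := fun x ↦ φ₂ x * L x with hF5
  set F6 : N → ℝ := fun x ↦ Pψu x / u x with hF6
  set F7 : N → ℝ := fun x ↦ L x * Pψf x / u x with hF7
  -- continuity of all the integrands
  have hK : IsClosed (tsupport ψ) := isClosed_tsupport ψ
  have hoff : ∀ (F : N → ℝ) (x : N), x ∉ tsupport ψ → ψ x * F x = 0 := fun F x hx ↦ by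
    rw [hψ0 hx, zero_mul]
  have hcψ : Continuous ψ := hψ.continuous
  have hcu : Continuous u := hu_s.continuous
  have hcL : Continuous L := hL_s.continuous
  have hcS : Continuous S := hS_s.continuous
  have hcΔu : Continuous ((ofRiemannian h).dalembertian u) := (contMDiff_dalembertian _ hu_s).continuous
  have hc_uu : Continuous Puu := continuous_innerDual_pair h (hu_s.of_le h1le) (hu_s.of_le h1le)
  have hc_Lf : Continuous PLf := continuous_innerDual_pair h (hL_s.of_le h1le) (hf.of_le h1le)
  have hc_uf : Continuous Puf := continuous_innerDual_pair h (hu_s.of_le h1le) (hf.of_le h1le)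
  have hc_ψu : Continuous Pψu := continuous_innerDual_pair h (hψ.of_le h1le) (hu_s.of_le h1le)
  have hc_ψf : Continuous Pψf := continuous_innerDual_pair h (hψ.of_le h1le) (hf.of_le h1le)
  have hu2ne : ∀ x ∈ tsupport ψ, u x ^ 2 ≠ 0 := fun x hx ↦ pow_ne_zero 2 (hsupp x hx)
  have hcu2 : Continuous fun x ↦ u x ^ 2 := hcu.pow 2
  have c1 : Continuous F1 := by
    refine (continuous_div_of_eq_zero_compl hK (hcψ.mul hcΔu) hcu (hoff _) hsupp).congr ?_
    intro x; simp only [hF1, hφ₁, Pi.mul_apply]; ring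
  have c2 : Continuous F2 :=
    continuous_div_of_eq_zero_compl hK (hcψ.mul hc_uu) hcu2 (hoff _) hu2ne
  have c3 : Continuous F3 :=
    continuous_div_of_eq_zero_compl hK (hcψ.mul hc_Lf) hcu (hoff _) hsupp
  have c4 : Continuous F4 := by
    refine (continuous_div_of_eq_zero_compl hK (hcψ.mul (hcL.mul hc_uf)) hcu2 (hoff _) hu2ne).congr ?_
    intro x; simp only [hF4, Pi.mul_apply]; ring
  have c5 : Continuous F5 := by
    refine (continuous_div_of_eq_zero_compl hK (hcψ.mul (hcL.mul hcL)) hcu (hoff _) hsupp).congr ?_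
    intro x; simp only [hF5, hφ₂, Pi.mul_apply]; ring
  have c6 : Continuous F6 := by
    refine continuous_div_of_eq_zero_compl hK hc_ψu hcu (fun x hx ↦ ?_) hsupp
    simp only [hPψu, hzero hx, innerDual, ContinuousLinearMap.toLinearMap_zero, LinearMap.zero_apply]
  have c7 : Continuous F7 := by
    refine continuous_div_of_eq_zero_compl hK (hcL.mul hc_ψf) hcu (fun x hx ↦ ?_) hsupp
    simp only [hPψf, hzero hx, innerDual, ContinuousLinearMap.toLinearMap_zero, LinearMap.zero_apply,
      mul_zero]
  -- compact support of all the integrands (inside `tsupport ψ`)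
  have hcs : ∀ F : N → ℝ, (∀ x, x ∉ tsupport ψ → F x = 0) → HasCompactSupport F := fun F hF ↦
    HasCompactSupport.intro' hψc.isCompact hK hF
  have s1 : HasCompactSupport F1 := hcs F1 fun x hx ↦ by
    simp only [hF1, hφ₁, hψ0 hx, zero_div, zero_mul]
  have s2 : HasCompactSupport F2 := hcs F2 fun x hx ↦ by
    simp only [hF2, hψ0 hx, zero_mul, zero_div]
  have s3 : HasCompactSupport F3 := hcs F3 fun x hx ↦ by
    simp only [hF3, hψ0 hx, zero_mul, zero_div]
  have s4 : HasCompactSupport F4 := hcs F4 fun x hx ↦ by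
    simp only [hF4, hψ0 hx, zero_mul, zero_div]
  have s5 : HasCompactSupport F5 := hcs F5 fun x hx ↦ by
    simp only [hF5, hφ₂, hψ0 hx, zero_mul, zero_div]
  have s6 : HasCompactSupport F6 := hcs F6 fun x hx ↦ by
    simp only [hF6, hPψu, hzero hx, innerDual, ContinuousLinearMap.toLinearMap_zero,
      LinearMap.zero_apply, zero_div]
  have s7 : HasCompactSupport F7 := hcs F7 fun x hx ↦ by
    simp only [hF7, hPψf, hzero hx, innerDual, ContinuousLinearMap.toLinearMap_zero,
      LinearMap.zero_apply, mul_zero, zero_div]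
  -- integrals as numbers
  have i1 := integrable_of_continuous_of_hasCompactSupport h c1 s1
  have i2 := integrable_of_continuous_of_hasCompactSupport h c2 s2
  have i3 := integrable_of_continuous_of_hasCompactSupport h c3 s3
  have i4 := integrable_of_continuous_of_hasCompactSupport h c4 s4
  have i5 := integrable_of_continuous_of_hasCompactSupport h c5 s5
  have i6 := integrable_of_continuous_of_hasCompactSupport h c6 s6
  have i7 := integrable_of_continuous_of_hasCompactSupport h c7 s7
  set μ := riemannianMeasure h with hμ
  -- Green (i): `∫ F1 = −∫ F6 + ∫ F2`
  have hA : ∫ x, F1 x ∂μ = -(∫ x, F6 x ∂μ) + ∫ x, F2 x ∂μ := by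
    have hP1int : ∫ x, P1 x ∂μ = (∫ x, F6 x ∂μ) - ∫ x, F2 x ∂μ := by
      calc ∫ x, P1 x ∂μ = ∫ x, (F6 x - F2 x) ∂μ :=
            integral_congr_ae (Eventually.of_forall fun x ↦ by simp only [hF6, hF2]; exact hdφ₁ x)
        _ = (∫ x, F6 x ∂μ) - ∫ x, F2 x ∂μ := integral_sub i6 i2
    have hG1' : ∫ x, F1 x ∂μ = -∫ x, P1 x ∂μ := hG1
    rw [hG1', hP1int]
    ring
  -- Green (ii): `∫ F5 = −∫ F7 − ∫ F3 + ∫ F4`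
  have hB : ∫ x, F5 x ∂μ = -(∫ x, F7 x ∂μ) - (∫ x, F3 x ∂μ) + ∫ x, F4 x ∂μ := by
    have hP2int : ∫ x, P2 x ∂μ = (∫ x, F7 x ∂μ) + (∫ x, F3 x ∂μ) - ∫ x, F4 x ∂μ := by
      calc ∫ x, P2 x ∂μ = ∫ x, (F7 x + F3 x - F4 x) ∂μ :=
            integral_congr_ae (Eventually.of_forall fun x ↦ by simp only [hF7, hF3, hF4]; exact hdφ₂ x)
        _ = (∫ x, (F7 x + F3 x) ∂μ) - ∫ x, F4 x ∂μ := integral_sub (i7.add i3) i4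
        _ = (∫ x, F7 x ∂μ) + (∫ x, F3 x ∂μ) - ∫ x, F4 x ∂μ := by rw [integral_add i7 i3]
    have hG2' : ∫ x, F5 x ∂μ = -∫ x, P2 x ∂μ := hG2
    rw [hG2', hP2int]
    ring
  -- the left-hand side
  have hmain : ∫ x, ψ x * S x ∂μ =
      (∫ x, F1 x ∂μ) - (∫ x, F2 x ∂μ) - 2 * (∫ x, F3 x ∂μ) + 2 * (∫ x, F4 x ∂μ)
        - 2 * (∫ x, F5 x ∂μ) := by
    have i3' : Integrable (fun x ↦ 2 * F3 x) μ := i3.const_mul 2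
    have i4' : Integrable (fun x ↦ 2 * F4 x) μ := i4.const_mul 2
    have i5' : Integrable (fun x ↦ 2 * F5 x) μ := i5.const_mul 2
    have j2 : Integrable (fun x ↦ F1 x - F2 x) μ := i1.sub i2
    have j3 : Integrable (fun x ↦ F1 x - F2 x - 2 * F3 x) μ := j2.sub i3'
    have j4 : Integrable (fun x ↦ F1 x - F2 x - 2 * F3 x + 2 * F4 x) μ := j3.add i4'
    calc ∫ x, ψ x * S x ∂μ
        = ∫ x, (F1 x - F2 x - 2 * F3 x + 2 * F4 x - 2 * F5 x) ∂μ :=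
          integral_congr_ae (Eventually.of_forall fun x ↦ by
            simp only [hF1, hF2, hF3, hF4, hF5]; exact hpt x)
      _ = (∫ x, (F1 x - F2 x - 2 * F3 x + 2 * F4 x) ∂μ) - ∫ x, 2 * F5 x ∂μ := integral_sub j4 i5'
      _ = (∫ x, (F1 x - F2 x - 2 * F3 x) ∂μ) + (∫ x, 2 * F4 x ∂μ) - ∫ x, 2 * F5 x ∂μ := by
          rw [integral_add j3 i4']
      _ = (∫ x, (F1 x - F2 x) ∂μ) - (∫ x, 2 * F3 x ∂μ) + (∫ x, 2 * F4 x ∂μ) - ∫ x, 2 * F5 x ∂μ := by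
          rw [integral_sub j2 i3']
      _ = (∫ x, F1 x ∂μ) - (∫ x, F2 x ∂μ) - (∫ x, 2 * F3 x ∂μ) + (∫ x, 2 * F4 x ∂μ)
            - ∫ x, 2 * F5 x ∂μ := by rw [integral_sub i1 i2]
      _ = _ := by rw [integral_const_mul, integral_const_mul, integral_const_mul]
  -- the right-hand side
  have hR : ∫ x, ((ofRiemannian h).innerDual x
          (mvfderiv I u x : TangentSpace I x →ₗ[ℝ] ℝ) (mvfderiv I ψ x : TangentSpace I x →ₗ[ℝ] ℝ)
        - 2 * L x * (ofRiemannian h).innerDual x (mvfderiv I f x : TangentSpace I x →ₗ[ℝ] ℝ)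
          (mvfderiv I ψ x : TangentSpace I x →ₗ[ℝ] ℝ)) / u x ∂μ =
      (∫ x, F6 x ∂μ) - 2 * ∫ x, F7 x ∂μ := by
    have hpt' : ∀ x, ((ofRiemannian h).innerDual x
          (mvfderiv I u x : TangentSpace I x →ₗ[ℝ] ℝ) (mvfderiv I ψ x : TangentSpace I x →ₗ[ℝ] ℝ)
        - 2 * L x * (ofRiemannian h).innerDual x (mvfderiv I f x : TangentSpace I x →ₗ[ℝ] ℝ)
          (mvfderiv I ψ x : TangentSpace I x →ₗ[ℝ] ℝ)) / u x = F6 x - 2 * F7 x := by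
      intro x
      have e1 : (ofRiemannian h).innerDual x
          (mvfderiv I u x : TangentSpace I x →ₗ[ℝ] ℝ) (mvfderiv I ψ x : TangentSpace I x →ₗ[ℝ] ℝ)
          = Pψu x := by
        simp only [hPψu]
        exact (ofRiemannian h).innerDual_comm x _ _
      have e2 : (ofRiemannian h).innerDual x
          (mvfderiv I f x : TangentSpace I x →ₗ[ℝ] ℝ) (mvfderiv I ψ x : TangentSpace I x →ₗ[ℝ] ℝ)
          = Pψf x := by
        simp only [hPψf]
        exact (ofRiemannian h).innerDual_comm x _ _
      rw [e1, e2]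
      simp only [hF6, hF7]
      ring
    calc ∫ x, ((ofRiemannian h).innerDual x
          (mvfderiv I u x : TangentSpace I x →ₗ[ℝ] ℝ) (mvfderiv I ψ x : TangentSpace I x →ₗ[ℝ] ℝ)
        - 2 * L x * (ofRiemannian h).innerDual x (mvfderiv I f x : TangentSpace I x →ₗ[ℝ] ℝ)
          (mvfderiv I ψ x : TangentSpace I x →ₗ[ℝ] ℝ)) / u x ∂μ
        = ∫ x, (F6 x - 2 * F7 x) ∂μ := integral_congr_ae (Eventually.of_forall hpt')
      _ = (∫ x, F6 x ∂μ) - ∫ x, 2 * F7 x ∂μ := integral_sub i6 (i7.const_mul 2)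
      _ = _ := by rw [integral_const_mul]
  rw [hmain, hR, hA, hB]
  ring

/-- **The curvature integral of the smeared sublevel sets of a function as a flux through its
levels.** For `f ∈ C^∞(N)` on a Riemannian surface (not necessarily compact), a cut-off profile
`η ∈ C^∞(ℝ)` such that `η ∘ f` has compact support, and `df ≠ 0` on `tsupport (η ∘ f)`:

  `∫_N (η ∘ f) S dμ = −∫_N η'(f) · (g⁻¹(d|∇f|², df) − 2 Δf |∇f|²) / |∇f|² dμ`

(`integral_mul_scalarCurvature_eq_neg_integral_flux_of_hasCompactSupport` with `ψ = η ∘ f`,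
`dψ = η'(f) df`). Where `|∇f|² ≠ 0` the density is `−2η'(f)·( g⁻¹(d|∇f|², df)/(2|∇f|²) − Δf )`,
and `( g⁻¹(d|∇f|², df)/(2|∇f|²) − Δf )/|∇f| = ⟨D_t γ', N⟩` is the signed geodesic curvature of
the unit-speed level curves of `f` with respect to the normal `N = grad f/|∇f|`
(`LevelCurveGeodesicCurvature.lean`): this is the boundary term `∫ κ_N ds` of the Gauss–Bonnet
formula (Lee 2018, Thm. 9.3) for the sublevel sets `{f ≤ σ}`, `σ ∈ supp η'`, integrated against
`−η'(σ) dσ` (coarea; not performed here) — the form in which Schoen–Yau 1979, (2.26), enters on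
the non-compact surface `S` with `f = r'`. [cite: Lee2018, Ch. 9, Thm. 9.3]
[cite: SchoenYauPMT1979, §2 (2.26)–(2.27)] -/
theorem integral_comp_mul_scalarCurvature_eq {f : N → ℝ} {η : ℝ → ℝ} (hf : CMDiff ∞ f)
    (hη : ContDiff ℝ ∞ η) (hc : HasCompactSupport (η ∘ f))
    (hsupp : ∀ x ∈ tsupport (η ∘ f), (ofRiemannian h).gradSq f x ≠ 0) :
    ∫ x, η (f x) * (ofRiemannian h).scalarCurvature x ∂riemannianMeasure h =
      -∫ x, deriv η (f x) *
          ((ofRiemannian h).innerDual x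
              (mvfderiv I ((ofRiemannian h).gradSq f) x : TangentSpace I x →ₗ[ℝ] ℝ)
              (mvfderiv I f x : TangentSpace I x →ₗ[ℝ] ℝ)
            - 2 * (ofRiemannian h).dalembertian f x * (ofRiemannian h).gradSq f x) /
          (ofRiemannian h).gradSq f x ∂riemannianMeasure h := by
  have hψ : CMDiff ∞ (η ∘ f) := hη.comp_contMDiff hf
  have key := integral_mul_scalarCurvature_eq_neg_integral_flux_of_hasCompactSupport h hf hψ hc
    hsupp
  have hL : (fun x ↦ (η ∘ f) x * (ofRiemannian h).scalarCurvature x) =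
      fun x ↦ η (f x) * (ofRiemannian h).scalarCurvature x := rfl
  rw [hL] at key
  rw [key]
  congr 1
  refine integral_congr_ae (Eventually.of_forall fun x ↦ ?_)
  -- `dψ = η'(f x) df`
  have hfx : MDifferentiableAt I 𝓘(ℝ, ℝ) f x := (hf x).mdifferentiableAt (by simp)
  have hchain : ((mvfderiv I (η ∘ f) x : TangentSpace I x →ₗ[ℝ] ℝ)) =
      deriv η (f x) • (mvfderiv I f x : TangentSpace I x →ₗ[ℝ] ℝ) := by
    apply LinearMap.ext
    intro v
    simp only [ContinuousLinearMap.coe_coe, LinearMap.smul_apply, smul_eq_mul]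
    exact mvfderiv_real_comp (hη.differentiable (by simp)).differentiableAt hfx v
  have hsm : ∀ α β : TangentSpace I x →ₗ[ℝ] ℝ, ∀ c : ℝ,
      (ofRiemannian h).innerDual x α (c • β) = c * (ofRiemannian h).innerDual x α β :=
    fun α β c ↦ by simp only [innerDual, map_smul, smul_eq_mul]
  simp only [hchain, hsm]
  have hu : (ofRiemannian h).innerDual x (mvfderiv I f x : TangentSpace I x →ₗ[ℝ] ℝ)
      (mvfderiv I f x : TangentSpace I x →ₗ[ℝ] ℝ) = (ofRiemannian h).gradSq f x := rfl
  rw [hu]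
  ring

end Core

end Literature.Geometry.Lorentzian

end
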